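import Literature.Computability.QuantumComplexity.Factoring
import Literature.Computability.Complexity.ProbabilisticClasses
import Literature.Computability.Complexity.PolyHierarchy
import Literature.Computability.Cryptography.ClassBQP
import HarnessLib
import HarnessLib.Audit
import HarnessLib.Audit.TribunalTags

/-!
# Strong-Hypothesis Library — summit `QuantumAdvantage` (D-0034, skeleton)

The REGISTRY of known strong hypotheses `H` (open conjectures with `H ⇒ P` landed or printed) for
the single-problem summit `QuantumAdvantage`. Every registered entry carries
`@[strong_hypothesis "QuantumAdvantage.QuantumAdvantage"]`; the kernel tribunal (`#h21_tribunal`,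
D-0033 T1 rule (a)) probes each registered `H` against a route crux `C` for `H → C`. Bridges `H → P`
live summit-side in `Summits/QuantumAdvantage/StrongHypotheses.lean` (where the one summit-side
conjecture, `FactoringAssumption`, is also tagged — Literature cannot import it). Nothing already in
the tree is restated; the two NEW decls below are famous one-line hypotheses that the tree so far used
only as anonymous hypotheses `(h : FACT ∉ BPP)` / census objects (`¬ (BQP ⊆ PH)`).

## The problem

* `QuantumAdvantage : Prop := Literature.QuantumAdvantage.BQPNotSubsetBPP`
  (`Summits/QuantumAdvantage/QuantumAdvantage/Statement.lean`, root name), with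
  `BQPNotSubsetBPP := ∃ L : Language Bool, L ∈ BQP ∧ L ∉ BPP` — the WITNESS form of "`BQP ≠ BPP`"
  (D-0015): some language is decided with two-sided error `≤ 1/3` by a polynomial-time uniform
  Clifford+T circuit family (`Literature.Computability.Cryptography.BQP`) and by no probabilistic
  polynomial-time TM (`Literature.Computability.Complexity.BPP`). Equivalent to the class inequality
  given `BPP ⊆ BQP` (landed: `Literature.Computability.QuantumComplexity.not_bqpEqBPP_iff_exists :
  ¬ BQPEqBPP ↔ ∃ L, L ∈ BQP ∧ L ∉ BPP`). It is a statement about DECISION problems (languages).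

## Census

| # | `H` | one-line statement | relation to `P` | source | status here | bridge |
|---|---|---|---|---|---|---|
| 1 | classical hardness of factoring (decision form) | `FACT ∉ BPP` (`FACT` = pairs `⟨N,k⟩` with a divisor `1 < d ≤ k`, Arora–Barak Ex. 2.3) | strictly stronger (`FACT ∈ BQP`, Shor) | Shor 1997 §1 ("so widely believed to be hard that several cryptosystems [are] based on their difficulty") and §5; Bernstein–Vazirani 1997 §1 | registered, NEW `Literature.StrongHypotheses.QuantumAdvantage.FACTNotMemBPP` | landed: `Summit.QuantumAdvantage.StrongHypotheses.factNotMemBPP_implies_quantumAdvantage` (witness `FACT`, `Literature.Computability.Cryptography.FACT_mem_BQP_holds`) |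
| 2 | `BQP ⊄ PH` | some `BQP` language lies outside the polynomial hierarchy | strictly stronger (`BPP ⊆ Σ₂ᵖ ⊆ PH`, Sipser–Gács–Lautemann) | Aaronson 2010 (*BQP and the polynomial hierarchy*, STOC), §1 — posed as the central open question/conjecture, with relational and oracle evidence; oracle form proved by Raz–Tal 2019 (in tree `OracleSeparationBQPPH.lean`) | registered, NEW `Literature.StrongHypotheses.QuantumAdvantage.BQPNotSubsetPH` | landed: `Summit.QuantumAdvantage.StrongHypotheses.bqpNotSubsetPH_implies_quantumAdvantage` (`BPP_subset_SigmaP_two`, `SigmaP_subset_PH`) |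
| 3 | the factoring assumption (average case, product of two random `m`-bit primes; Goldreich 2001 §2.2.4.1, Katz–Lindell §8.2.3) | every PPT `A` finds `min P Q` from `(1ᵐ, P·Q)` with negligible probability | strictly stronger (⇒ #1 ⇒ `P`) | Goldreich 2001 §2.2.4.1; "broken by Shor" ibid./Katz–Lindell | registered, existing summit-side `Summit.QuantumAdvantage.QuantumAdvantage.Theorems.FactoringAssumption` (`@[conjecture]`, `Theorems/FactoringAssumption.lean`; tagged in the summit file) | printed: `Summit.QuantumAdvantage.StrongHypotheses.FactoringAssumptionImpliesQuantumAdvantage` |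
| 4 | classical hardness of fundamental-discriminant / squarefreeness testing | `FUND ∉ BPP`, `SQF ∉ BPP` (`encodingNatBool.toLanguage {m | Squarefree m} ∉ BPP`; Adleman–McCurley 1994 open problem) | strictly stronger (`SQF ≤ₚ FUND ∈ BQP` via Shor, landed `fund_mem_BQP`, `squarefree_mem_BQP`) | Adleman–McCurley 1994 (open problems list); landed bridges `Summit.QuantumAdvantage.QuantumAdvantage.Theorems.IqThreeNotPPoly.quantumAdvantage_of_squarefree_not_mem_BPP`, `.quantumAdvantage_of_fund_not_mem_BPP` (`Theorems/ArithStatLadderIqThreeNotPPolyApexBQP.lean`) | candidate (not yet in tree as closed `Prop`s; posed in print as an open PROBLEM rather than a conjecture; the skeleton's two new-decl slots are spent on #1–#2) | none here (landed implications exist, named above) |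
| 5 | classical hardness of discrete log (decision form) | `DLOGHalf ∉ BPP` (`Literature.Computability.Cryptography.DLOGHalf`, Blum–Micali predicate) | strictly stronger in print (Shor 1997 §6: DLOG ∈ FBQP) | Shor 1997 §1, §6; Blum–Micali 1984 | candidate (typeable; NOT registered: `DLOGHalf ∈ BQP` is not landed, so the bridge would be printed; budget) | none |
| 6 | Φ-hiding, worst case, `e = 3` | no PPT decides `[3 ∣ φ(N)]` on squarefree semiprimes `N ≡ 1 (9)` off the `(8,8)` class | strictly stronger (landed `quantumAdvantage_of_phiHidingThree`) | Cachin–Micali–Stadler 1999 §2 (average-case Φ-hiding); the tree's form is bespoke | existing summit-side `Summit.QuantumAdvantage.QuantumAdvantage.Theorems.PhiHidingThree` — deliberately NOT registered (see below) | (landed in tree, not tagged) |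

## Deliberately NOT registered

* `Summit.QuantumAdvantage.QuantumAdvantage.Theorems.PhiHidingThree` (#6): by its own file it is the NAME
  of a route stub (`phiHidingThree_iff_stub : PhiHidingThree ↔ stub_phiHiding3`, crux
  `PureCubicClassNumberHard` of route `LinnikCubicClassGroups`), i.e. a route leaf promoted to a
  `@[conjecture] def`; tagging it would certify that crux by construction (circular in the sense of the
  tribunal). The printed Φ-hiding assumption (CMS 1999, average case, all small `e`) is not in the tree.
* `Summit.QuantumAdvantage.QuantumAdvantage.Theorems.AcZeroRung.Negative.AcZeroRung` — a former route item
  kept as `@[conjecture] def`, POSED IN THIS PROJECT; not a known hypothesis.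
* Route cruxes / census objects (`Theses` decls and `Cruxes/…` files): `ParityFrontier.Target`
  (`BQP ⊄ BP·⊕P`), `Cruxes/Target/StrategyCensus.BQPNotPH` (an undocumented census `def`, same statement
  as #2 — the registered Literature decl #2 supersedes it), `PPNotBPParity`, `PHNotBPP`, `WbwThesis`,
  `LanguageLadder`, `DyadicGapProbes.EHard`/`QSignNotInP` …: cruxes are what the tribunal probes.
* The NEGATION summit `Literature.Computability.QuantumComplexity.BQPEqBPP` (`BQP = BPP`): its negation IS
  the summit (`not_bqpEqBPP_iff_exists`), so it is neither a strong hypothesis nor a criterion to tag.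
* WEAKER than `P` (consequences): `Literature.Barriers.QuantumAdvantage.PPolyOracleSeparation`
  (`pPolyOracleSeparation_of_BPP_ne_BQP`), `PromiseBQP ≠ PromiseBPP`, `BQP ≠ P`, `¬ FactInP`
  (`FACT ∉ P`), oracle and query separations (Simon, Forrelation, Raz–Tal, `OracleSeparations*.lean`,
  all theorems).
* NOT BRIDGES TO THIS `P` (sampling / relational advantage, no printed implication to a LANGUAGE in
  `BQP ∖ BPP`): the permanent-of-Gaussians conjecture and anticoncentration
  (`Literature.Computability.QuantumComplexity.PermanentOfGaussiansConjecture`, `…ConjectureRand`,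
  `PermanentAntiConcentrationConjecture`; Aaronson–Arkhipov 2011: with non-collapse of `PH` they give
  hardness of approximate BosonSampling, a `SampBPP ≠ SampBQP`-type statement), IQP hardness
  (`UniformIQPMultiplicativeSimulation`, Bremner–Jozsa–Shepherd 2011), the Aaronson–Ambainis conjecture
  (`AAConjecture`, which points the OTHER way: quantum query algorithms are classically simulable on most
  inputs), proofs of quantumness from LWE / trapdoor claw-free functions (Brakerski et al. 2018;
  interactive), Yamakawa–Zhandry 2022 (`NP`-search advantage relative to random oracles). Registering
  any of them with a bridge would be a smuggled lemma.
* WRONG DIRECTION (quantum HARDNESS assumptions): `Literature.Algebra.EuclideanLattices.GapSVPQuantumHardness`,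
  `Literature.Computability.Cryptography.LWENotInBQP`; and classical cryptographic primitives with no
  quantum content (`OWFExist`, `PRGExist`, `SecurePKEExist`, `IOExist`, …) do not imply `P`.

## Not yet typeable

* "`PromiseBQP`-complete problems are classically hard" in LANGUAGE form (e.g. additive Jones-polynomial
  approximation, `JonesInBQP*.lean`, is a PROMISE problem; a language version equivalent to `P` is not in
  print).
* Pell's equation / principal ideal problem `∉ BPP` (Hallgren 2007): the tree has Hallgren's class-group
  blocks (`Cryptography/HallgrenClassGroup*.lean`) but no `PELL` language with `PELL ∈ BQP`.

## Sources (keys in `lean/references.bib`)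

[Shor1997SICOMP] §1, §5, §6; [BernsteinVazirani1997SICOMP] §1, §8; [Aaronson2010] §1 (interim key of the
tree covering Aaronson's 2010 papers; here: *BQP and the polynomial hierarchy*, STOC 2010, as already used
by `OracleSeparationBQPPH.lean`); [RazTalJACM2022]; [Goldreich2001] §2.2.4.1; [KatzLindell2014] §8.2.3;
[AdlemanMcCurley1994]; [BlumMicali1984] §3; [CachinMicaliStadler1999] §2; [AaronsonArkhipov2011];
[BremnerJozsaShepherdPRSA2011]; [YamakawaZhandry2022FOCS]; [Stockmeyer1976] §3; [AroraBarak2009] Ex. 2.3.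
-/

noncomputable section

namespace Literature.StrongHypotheses.QuantumAdvantage

open Literature.Computability.Complexity (BPP PH)
open Literature.Computability.Cryptography (BQP)
open Literature.Computability.QuantumComplexity (FACT)

/-! ## New closed statements (two) -/

/-- OPEN CONJECTURE — **factoring is classically hard, decision form: `FACT ∉ BPP`.** `FACT` is the
language of pairs `⟨N, k⟩` such that `N` has a divisor `d` with `1 < d ≤ k` (Arora–Barak 2009, Ex. 2.3;
`Literature.Computability.QuantumComplexity.FACT`), polynomial-time equivalent to the search problem of
integer factorisation (binary search on `k`); `BPP` is the tree's `Literature.Computability.Complexity.BPP`.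
The hypothesis is the standard belief recorded by Shor, *Polynomial-time algorithms for prime factorization
and discrete logarithms on a quantum computer*, SIAM J. Comput. 26 (1997), §1: factoring and discrete
logarithms "are so widely believed to be hard that several cryptosystems based on their difficulty have
been proposed, including the widely used RSA public key cryptosystem" — read for probabilistic
polynomial time (the class against which `BQP` is measured, ibid. §1: "By analogy with the classical class
BPP, this class is called BQP"). STRICTLY STRONGER than the summit `∃ L, L ∈ BQP ∧ L ∉ BPP`: `FACT ∈ BQP`
is Shor's theorem (ibid. §5; in tree, discharged: `Literature.Computability.Cryptography.FACT_mem_BQP_holds`),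
so `FACT` itself is the witness — bridge LANDED, summit file. Open: neither `FACT ∈ BPP` nor `FACT ∉ BPP`
is proved (the latter would give `P ≠ NP`-strength consequences: `FACT ∈ NP ∩ coNP`, in tree
`FACT_mem_NP_inter_coNP`). [cite: Shor1997SICOMP, §1 (belief) and §5 (FACT ∈ BQP)] [status: open] -/
@[conjecture, strong_hypothesis "QuantumAdvantage.QuantumAdvantage"]
def FACTNotMemBPP : Prop :=
  FACT ∉ BPP

/-- OPEN CONJECTURE — **`BQP ⊄ PH`**: not every language decided in bounded-error quantum polynomial
time lies in the polynomial hierarchy `PH = ⋃ₖ Σₖᵖ` (`Literature.Computability.Complexity.PH`,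
Stockmeyer 1976). Posed by S. Aaronson, *BQP and the polynomial hierarchy*, STOC 2010, §1, as "the
relationship between BQP and PH has been an open problem since the earliest days of quantum computing",
with the conjecture that `BQP ⊄ PH` supported there by a relational separation and by the (generalized
Linial–Nisan ⇒) oracle separation programme, the oracle separation itself being Raz–Tal 2019 (in tree:
`Literature/Computability/QuantumComplexity/OracleSeparationBQPPH.lean`). The UNRELATIVIZED statement is
open (with `BQP ⊆ PSPACE` it would give `PH ≠ PSPACE`). STRICTLY STRONGER than the summit: `BPP ⊆ Σ₂ᵖ ∩ Π₂ᵖ ⊆ PH`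
(Sipser–Gács 1983 / Lautemann 1983; in tree `BPP_subset_SigmaP_two`, `SigmaP_subset_PH`), so a `BQP`
language outside `PH` is outside `BPP` — bridge LANDED, summit file. The bib key `Aaronson2010` is the
tree's interim key for Aaronson's 2010 papers (already used for this paper by `OracleSeparationBQPPH.lean`).
[cite: Aaronson2010, §1] [status: open] -/
@[conjecture, strong_hypothesis "QuantumAdvantage.QuantumAdvantage"]
def BQPNotSubsetPH : Prop :=
  ¬ (BQP ⊆ PH)

end Literature.StrongHypotheses.QuantumAdvantage

end
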